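/-
COR-CM (cells pub-hodgecm / pub-hodgecm2, stage 2 of the Hodge ladder) — TRANSPOSITION SURGE, item (vi) sub-binder S2, TEAM hComp
(coordinator ruling 2026-08-21T18:44:30Z), sub-object U5 (assembly) of the owner's spec `HOME/pinning/HCOMP-ANATOMY.md` v1.2 / HCOMP-TABLE v1.1: the
ENGINES producing the binders `hUnif` (PATH A, from the record's pieces) and `hTree` (RESERVE B, from per-component ball data) of
`Transposition/Item6PinReachAlong.lean` §2/§5, given a complex model of each slot.  Seat prover-pub-hodgecm2-pin-1-g2-0 (pin-1 gen 2, owner of record of binder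
`hComp`; team path `Transposition/HComp/` per the pub-hodgecm2 lead's staging 18:45:07Z, tabled by hcomp-lead).  THEOREMS ONLY: no
definition, no instance, no named fact, no `variable`, nothing asserted, no proof holes; `h₁`/`h₃` are explicit binders needed only
to STATE the tree surfaces.  Nothing in the tree is edited or restated.  FRAMING: HC_CM is NOT proved.
-/
import Literature.AlgebraicGeometry.HodgeTheory.SmoothProjectiveComponents
import Summits.HodgeConjecture.CorCM.AlbaneseSideModelMatch
import Literature.NumberTheory.Automorphic.Liu2021.AppendixC.Glue
import Literature.AlgebraicGeometry.Motives.BaseChange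
import HarnessLib

/-!
# TEAM hComp, U5 engines: `hUnif` / `hTree` from a complex model of the slot and its pieces

The binder `hTree` of `Model.hUnif_of_treeCofan_along` / `Model.pinReach_of_treeCofan_of_alb_along` (`Transposition/Item6PinReachAlong.lean`
§5) asks, level by level, that Liu's isometry-type Shimura variety base-changed to `ℂ` be a finite COPRODUCT (colimit cofan in
`SchemeOver ℂ`) of tree surfaces `P_{Γ_c}(V) := Var.scheme (ballQuotientUniformisedDatum_of h₁) h₃ (.pms (pmsCode F ι₁ V (Γ c)))`.  This file
reduces that, for ANY complex scheme `Y` smooth of relative dimension `2` and projective over `ℂ`, to a PER-COMPONENT statement: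

* `Model.hUnif_of_slotIso_of_pieces` — PATH A (HCOMP-TABLE v1.1 D-1): the binder `hUnif` VERBATIM from, level by level, a complex model
  `Y … K` of the slot (iso `slot`) and a finite colimit cofan of PIECES with ball data of the `V`-tower shape (the record's field `pieces`).
* `Model.hTree_of_slotIso_of_pieces` — RESERVE B: the binder `hTree` VERBATIM from, level by level, a smooth projective complex model `Y … K` of
  the slot (iso `slot`, rows U2a/U2b) and the per-piece ball data on it (rows U4′a/U4′b).
* `Model.exists_treeCofan_of_pieces` — if every open-and-closed geometrically irreducible smooth projective piece `E ↪ Y` carries a ball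
  uniformisation datum `D : UnitaryBallUniformisationDatum 2 E` of the `V`-tower shape (`D.Hℂ = V.Hm^{ι₁}`, group `ι₁(Γ)` for a level
  `Γ : Level V`), then `Y` is a finite coproduct of tree surfaces `P_{Γ_c}(V)`.

KERNEL (ours, glue only): the components of `Y` form a finite colimit cofan (tree `HodgeTheory.exists_components_isSmoothProjective_isColimit`,
Görtz–Wedhorn I Ex. 3.16 + Stacks 0BA8); each component IS a tree surface by the model match (tree `Model.nonempty_iso_pms_of_ballDatum`,
item6-p2 p297357: Mumford AG I (4.15) via `UnitaryBallModelUnique.exists_iso_of_eq`, read in the real Hodge models of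
`exists_isReal_hodgeModel_holds`); a cofan stays a colimit when its legs are precomposed with isomorphisms (`IsColimit.precomposeHomEquiv`).
The per-piece hypothesis is the deliverable of hcomp-compare-2 (pieces of `M_K ⊗_{E,ι₁} ℂ` for the canonical-model record: points by
`pts` + Deligne's dissection `Deligne1979.image_eq_piece_of_isClopen` / `exists_components_homeomorph_ballQuotient`, holomorphy by `hol`).
HC_CM is NOT proved; nothing here is inhabited beyond glue.

References: U. Görtz, T. Wedhorn, *Algebraic Geometry I* (2020) Ex. 3.16; Stacks Project Tag 0BA8; D. Mumford, *Algebraic Geometry I*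
(1981) §4B (4.15); P. Deligne, *Variétés de Shimura* (Corvallis 1979) §2.1.2.
-/

noncomputable section

namespace Summit.HodgeConjecture.CorCM.Model

open CategoryTheory CategoryTheory.Limits AlgebraicGeometry NumberField
open Literature.AlgebraicGeometry.Motives
open Literature.AlgebraicGeometry.HodgeTheory
open Literature.AlgebraicGeometry.ShimuraVarieties
open Literature.NumberTheory.Automorphic
open Literature.NumberTheory.Automorphic.PicardCM
open Literature.NumberTheory.Automorphic.Liu2021
open Literature.NumberTheory.Automorphic.Liu2021.AppendixC

universe v u

/-- A colimit cofan stays a colimit cofan when every leg is precomposed with an isomorphism (change of the summands up to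
isomorphism; Mathlib `IsColimit.precomposeHomEquiv` along `Discrete.natIso`, `Cocone.precompose`). [folklore] -/
theorem nonempty_isColimit_cofan_of_iso {C : Type u} [Category.{v} C] {ι : Type} {E P : ι → C} {Y : C} (e : ∀ i, E i ⟶ Y)
    (hc : IsColimit (Cofan.mk Y e)) (φ : ∀ i, P i ≅ E i) :
    Nonempty (IsColimit (Cofan.mk Y (fun i => (φ i).hom ≫ e i))) := by
  let α : Discrete.functor P ≅ Discrete.functor E := Discrete.natIso (fun ⟨i⟩ => φ i)
  have h : IsColimit ((Cocone.precompose α.hom).obj (Cofan.mk Y e)) := (IsColimit.precomposeHomEquiv α _).symm hc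
  refine ⟨IsColimit.ofIsoColimit h (Cofan.ext (Iso.refl _) (fun i => ?_))⟩
  change ((φ i).hom ≫ e i) ≫ 𝟙 Y = (φ i).hom ≫ e i
  exact Category.comp_id _

/-- **A smooth projective complex surface whose components are ball quotients of the `V`-tower is a finite coproduct of tree surfaces.**
Let `Y` be smooth of relative dimension `2` and projective over `ℂ`, and suppose every piece `j : E ↪ Y` that is an open AND closed
immersion with `E` a smooth projective geometrically irreducible surface carries a ball uniformisation datum `D` with complex Gram
matrix `V.Hm^{ι₁}` and group `ι₁(Γ)` for some level `Γ : Level V` (`2 < [F:ℚ]`, so the codes are anisotropic).  Then there are finitely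
many levels `Γ_c` and morphisms `inj_c : P_{Γ_c}(V) ⟶ Y` forming a colimit cofan: `Y ≅ ∐_c P_{Γ_c}(V)` — exactly the level-`K` clause of the
binder `hTree` (with `Y` = Liu's `Sh(G(τ), h_{V(τ),e ι₁})_K ⊗ ℂ`).  Glue, ours: components by
`HodgeTheory.exists_components_isSmoothProjective_isColimit`, model match by `Model.nonempty_iso_pms_of_ballDatum` (item6-p2) in the real Hodge
models `exists_isReal_hodgeModel_holds`, change of summands by `nonempty_isColimit_cofan_of_iso`.  The hypothesis `hpiece` is not inhabited
here (TEAM hComp, hcomp-compare-2).  HC_CM is NOT proved. [cite: GortzWedhorn2020, Exercise 3.16 (p. 117)] [cite: Mumford1981, §4B (4.15) Corollary, p. 67] -/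
theorem exists_treeCofan_of_pieces
    (h₁ : BallQuotientUniformised) (h₃ : CMAbelianVarietyRealised)
    {F : CMField} (hF : 2 < Module.finrank ℚ F) {ι₁ : F →+* ℂ} (V : HermSpace3 F ι₁)
    (Y : SchemeOver ℂ) [SmoothOfRelativeDimension 2 Y.hom] (hY : IsProjectiveOver Y)
    (hpiece : ∀ (E : SchemeOver ℂ) (j : E ⟶ Y), IsSmoothProjective 2 E → IsOpenImmersion j.left → IsClosedImmersion j.left →
      ∃ (Γ : Level V) (D : UnitaryBallUniformisationDatum 2 E),
        D.Hℂ = V.Hm.map ι₁ ∧ D.Γ.map (Matrix.GeneralLinearGroup.map D.τ₁) = Γ.Γ.map (Matrix.GeneralLinearGroup.map ι₁)) :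
    ∃ (Cset : Type) (_ : Fintype Cset) (Γ : Cset → Level V)
      (inj : ∀ c, Var.scheme (ballQuotientUniformisedDatum_of h₁) h₃ (.pms (pmsCode F ι₁ V (Γ c))) ⟶ Y),
      Nonempty (IsColimit (Cofan.mk Y inj)) := by
  classical
  obtain ⟨Cset, hfin, E, e, hE, hopen, hclosed, -, ⟨hcol⟩⟩ := exists_components_isSmoothProjective_isColimit (d := 2) hY
  haveI : Fintype Cset := Fintype.ofFinite Cset
  -- each component is a tree surface
  have hiso : ∀ c, ∃ Γ : Level V, Nonempty (E c ≅ Var.scheme (ballQuotientUniformisedDatum_of h₁) h₃ (.pms (pmsCode F ι₁ V Γ))) := by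
    intro c
    obtain ⟨Γ, D, hH, hΓ⟩ := hpiece (E c) (e c) (hE c) (hopen c) (hclosed c)
    exact ⟨Γ, nonempty_iso_pms_of_ballDatum (ballQuotientUniformisedDatum_of h₁) h₃ exists_isReal_hodgeModel_holds hF D Γ hH hΓ⟩
  choose Γ hΓ using hiso
  let φ : ∀ c, Var.scheme (ballQuotientUniformisedDatum_of h₁) h₃ (.pms (pmsCode F ι₁ V (Γ c))) ≅ E c := fun c => (hΓ c).some.symm
  exact ⟨Cset, inferInstance, Γ, fun c => (φ c).hom ≫ e c, nonempty_isColimit_cofan_of_iso e hcol φ⟩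

/-! ## §2  The binder `hTree` of `Item6PinReachAlong.lean` §5 from slot isomorphisms and per-piece ball data -/

/-- **`hTree` (level by level: Liu's isometry-type Shimura variety base-changed to `ℂ` is a finite coproduct of tree surfaces) from
(i) level by level, a complex MODEL `Y` of the slot (existential) — an isomorphism `slot` in `SchemeOver ℂ` between
`Sh(G(τ), h_{V(τ),e ι₁})_{fix τ K} ⊗_{(e ι₁)(E)} ℂ` (the consumer's carrier `(P5 …).Sh τ (e ι₁)`, App. C Rem. C.2) and a complex scheme `Y … K`
smooth of relative dimension `2` and projective (TEAM hComp rows U2a/U2b: the honest `P5` built from the canonical-model record system and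
the ῑ₁-slot identification with `M_K ⊗_{E,ι₁} ℂ`), below some open compact `Ksm`, and (ii) per-piece ball data on every `Y … K` (rows
U4′a/U4′b, the hypothesis `hpiece` of `exists_treeCofan_of_pieces`).**  The conclusion is VERBATIM the binder `hTree` of
`Model.hUnif_of_treeCofan_along` / `Model.pinReach_of_treeCofan_of_alb_along` for the same `e`, `P5`.  Glue, ours (`exists_treeCofan_of_pieces`
+ transport of the cofan along `slot`).  HC_CM is NOT proved; `slot`, `hpiece` are not inhabited here.
[cite: GortzWedhorn2020, Exercise 3.16 (p. 117)] [cite: Mumford1981, §4B (4.15) Corollary, p. 67] -/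
theorem hTree_of_slotIso_of_pieces
    (h₁ : BallQuotientUniformised) (h₃ : CMAbelianVarietyRealised)
    (e : ∀ (F : CMField), (F →+* ℂ) → (F →+* ℂ))
    (P5 : ∀ (F : CMField) (ι₁ : F →+* ℂ) (_ : HermSpace3 F ι₁) (_ : CMType F), PropC5Data (maximalRealSubfield F) F)
    (hY : ∀ (F : CMField), IsGalois ℚ F → 6 ≤ Module.finrank ℚ F → ∀ (Φ : CMType F) (ι₁ : F →+* ℂ), ι₁ ∈ Φ.1 →
      ∀ (V : HermSpace3 F ι₁) (τ : maximalRealSubfield F →+* ℝ), C5.IsAbove τ (e F ι₁) →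
        ∃ Ksm : Subgroup (P5 F ι₁ V Φ).G, IsOpenCompact Ksm ∧
          ∀ K : C5.OpenCompactSubgroup (P5 F ι₁ V Φ).G, K.1 ≤ Ksm →
            ∃ (Y : SchemeOver ℂ) (_ : (baseChangeHom (e F ι₁).fieldRange.subtype).obj
                (((P5 F ι₁ V Φ).Sh τ (e F ι₁)).obj (C5.OpenCompactSubgroup.transport ((P5 F ι₁ V Φ).fix τ) K)) ≅ Y)
              (_ : SmoothOfRelativeDimension 2 Y.hom), IsProjectiveOver Y ∧
            ∀ (E : SchemeOver ℂ) (j : E ⟶ Y), IsSmoothProjective 2 E → IsOpenImmersion j.left → IsClosedImmersion j.left →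
              ∃ (Γ : Level V) (D : UnitaryBallUniformisationDatum 2 E),
                D.Hℂ = V.Hm.map ι₁ ∧ D.Γ.map (Matrix.GeneralLinearGroup.map D.τ₁) = Γ.Γ.map (Matrix.GeneralLinearGroup.map ι₁)) :
    ∀ (F : CMField), IsGalois ℚ F → 6 ≤ Module.finrank ℚ F → ∀ (Φ : CMType F) (ι₁ : F →+* ℂ), ι₁ ∈ Φ.1 →
      ∀ (V : HermSpace3 F ι₁) (τ : maximalRealSubfield F →+* ℝ), C5.IsAbove τ (e F ι₁) →
        ∃ Ksm : Subgroup (P5 F ι₁ V Φ).G, IsOpenCompact Ksm ∧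
          ∀ K : C5.OpenCompactSubgroup (P5 F ι₁ V Φ).G, K.1 ≤ Ksm →
            ∃ (Cset : Type) (_ : Fintype Cset) (Γ : Cset → Level V)
              (inj : ∀ c, Var.scheme (ballQuotientUniformisedDatum_of h₁) h₃ (.pms (pmsCode F ι₁ V (Γ c))) ⟶
                (baseChangeHom (e F ι₁).fieldRange.subtype).obj
                  (((P5 F ι₁ V Φ).Sh τ (e F ι₁)).obj (C5.OpenCompactSubgroup.transport ((P5 F ι₁ V Φ).fix τ) K))),
              Nonempty (IsColimit (Cofan.mk _ inj)) := by
  intro F hG h6 Φ ι₁ hι V τ hτ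
  obtain ⟨Ksm, hKsm, h⟩ := hY F hG h6 Φ ι₁ hι V τ hτ
  refine ⟨Ksm, hKsm, fun K hK => ?_⟩
  obtain ⟨Y, slot, hsm, hproj, hpiece⟩ := h K hK
  have hF : 2 < Module.finrank ℚ F := by omega
  obtain ⟨Cset, _, Γ, inj, ⟨hcol⟩⟩ := exists_treeCofan_of_pieces h₁ h₃ hF V Y hproj hpiece
  exact ⟨Cset, inferInstance, Γ, fun c => inj c ≫ slot.inv, ⟨hcol.ofIsoColimit (Cofan.ext slot.symm (fun c => rfl))⟩⟩

/-! ## §3  PATH A (HCOMP-TABLE v1.1 D-1): the binder `hUnif` from slot isomorphisms and the record's PIECES (data) -/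

/-- **`hUnif` (the binder of `Model.hComp_of_unif_of_alb_along`, `Item6PinReachAlong.lean` :158–169) from, level by level, a complex
scheme `Y` (existential) with an isomorphism `slot` to Liu's `Sh(G(τ), h_{V(τ),e ι₁})_{fix τ K} ⊗_{(e ι₁)(E)} ℂ` and a finite cofan colimit of
PIECES `X c ⟶ Y … K` carrying ball data of the `V`-tower shape (`(B c).Hℂ = V.Hm^{ι₁}`, group `ι₁(Γ_c)`, `Γ_c : Level V`)** — exactly the
shape of the field `pieces` of the canonical-model record system (`Literature/AlgebraicGeometry/ShimuraVarieties/UnitaryShimuraCanonicalModel.lean`,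
`RecordSystem.pieces`, htheta-x1: [Deligne 1979, 2.1.2 + 2.2.5; Milne ISV Lemma 5.13]) at `(L, H, τ) := (F, V.Hm, ι₁)`, `Y … K := M_K ⊗_{E,ι₁} ℂ`,
with the natural levels named as `Level V`'s (TEAM hComp rows U1⁺, U2a/BC (slot), U2c (levels)).  The conclusion is `hUnif` VERBATIM; the
kernel only moves the cofan along `slot`.  Glue, ours.  HC_CM is NOT proved; `hY` is not inhabited here.
[cite: Deligne1979ShimuraVarieties, §2.1.2 and 2.2.5] -/
theorem hUnif_of_slotIso_of_pieces
    (e : ∀ (F : CMField), (F →+* ℂ) → (F →+* ℂ))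
    (P5 : ∀ (F : CMField) (ι₁ : F →+* ℂ) (_ : HermSpace3 F ι₁) (_ : CMType F), PropC5Data (maximalRealSubfield F) F)
    (hY : ∀ (F : CMField), IsGalois ℚ F → 6 ≤ Module.finrank ℚ F → ∀ (Φ : CMType F) (ι₁ : F →+* ℂ), ι₁ ∈ Φ.1 →
      ∀ (V : HermSpace3 F ι₁) (τ : maximalRealSubfield F →+* ℝ), C5.IsAbove τ (e F ι₁) →
        ∃ Ksm : Subgroup (P5 F ι₁ V Φ).G, IsOpenCompact Ksm ∧
          ∀ K : C5.OpenCompactSubgroup (P5 F ι₁ V Φ).G, K.1 ≤ Ksm →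
            ∃ (Y : SchemeOver ℂ) (_ : (baseChangeHom (e F ι₁).fieldRange.subtype).obj
                (((P5 F ι₁ V Φ).Sh τ (e F ι₁)).obj (C5.OpenCompactSubgroup.transport ((P5 F ι₁ V Φ).fix τ) K)) ≅ Y)
              (Cset : Type) (_ : Fintype Cset) (X : Cset → SchemeOver ℂ) (ι : ∀ c, X c ⟶ Y)
              (_ : IsColimit (Cofan.mk Y ι)) (B : ∀ c, UnitaryBallUniformisationDatum 2 (X c)) (Γ : Cset → Level V),
              ∀ c, (B c).Hℂ = V.Hm.map ι₁ ∧
                (B c).Γ.map (Matrix.GeneralLinearGroup.map (B c).τ₁) = (Γ c).Γ.map (Matrix.GeneralLinearGroup.map ι₁)) :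
    ∀ (F : CMField), IsGalois ℚ F → 6 ≤ Module.finrank ℚ F → ∀ (Φ : CMType F) (ι₁ : F →+* ℂ), ι₁ ∈ Φ.1 →
      ∀ (V : HermSpace3 F ι₁) (τ : maximalRealSubfield F →+* ℝ), C5.IsAbove τ (e F ι₁) →
        ∃ Ksm : Subgroup (P5 F ι₁ V Φ).G, IsOpenCompact Ksm ∧
          ∀ K : C5.OpenCompactSubgroup (P5 F ι₁ V Φ).G, K.1 ≤ Ksm →
            ∃ (Cset : Type) (_ : Fintype Cset) (X : Cset → SchemeOver ℂ) (B : ∀ c, UnitaryBallUniformisationDatum 2 (X c))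
              (Γ : Cset → Level V)
              (inj : ∀ c, X c ⟶ (baseChangeHom (e F ι₁).fieldRange.subtype).obj
                (((P5 F ι₁ V Φ).Sh τ (e F ι₁)).obj (C5.OpenCompactSubgroup.transport ((P5 F ι₁ V Φ).fix τ) K))),
              (∀ c, (B c).Hℂ = V.Hm.map ι₁) ∧
              (∀ c, (B c).Γ.map (Matrix.GeneralLinearGroup.map (B c).τ₁) =
                (Γ c).Γ.map (Matrix.GeneralLinearGroup.map ι₁)) ∧
              Nonempty (IsColimit (Cofan.mk _ inj)) := by
  intro F hG h6 Φ ι₁ hι V τ hτ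
  obtain ⟨Ksm, hKsm, h⟩ := hY F hG h6 Φ ι₁ hι V τ hτ
  refine ⟨Ksm, hKsm, fun K hK => ?_⟩
  obtain ⟨Y, slot, Cset, _, X, ι, hcol, B, Γ, hB⟩ := h K hK
  exact ⟨Cset, inferInstance, X, B, Γ, fun c => ι c ≫ slot.inv, fun c => (hB c).1, fun c => (hB c).2,
    ⟨hcol.ofIsoColimit (Cofan.ext slot.symm (fun c => rfl))⟩⟩

end Summit.HodgeConjecture.CorCM.Model

end
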